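import Literature.NumberTheory.EllipticCurves.QuadraticTwistKroneckerLFunctionProofs
import Literature.NumberTheory.EllipticCurves.QuadraticTwistRamifiedLocalPolynomialProofs
import HarnessLib

/-!
# `aₙ(E^{(d_K)}) = χ_{d_K}(n) aₙ(E)` for a quadratic field of even discriminant `d_K = 4m`

Let `E / ℚ` be an elliptic curve and `K` a quadratic field of **even** discriminant `D = d_K = 4m`
such that `E` has good reduction at every prime dividing `D`. Then for Mathlib's `L`-function of
the quadratic twist `E^{(D)}` (`WeierstrassCurve.quadraticTwist`), for all `n ≥ 1`,

`aₙ(E^{(D)}) = χ_D(n) · aₙ(E)`,  `χ_D(n) = (m / n)` for odd `n`, `χ_D(n) = 0` for even `n`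

(`LFunction_quadraticTwist_apply_of_four_dvd_discr`; the Kronecker character of `K`, Cox Lemma 1.14,
the tree's `KroneckerCharacterFourProofs`). Companion of the odd-discriminant file
`QuadraticTwistKroneckerLFunctionProofs`; the Euler factors are compared place by place:

* at an odd place `v ∤ D` (prime `ℓ`): `D` is an `ℓ`-adic unit, a square mod `ℓ` iff
  `(D / ℓ) = (4 / ℓ)(m / ℓ) = (m / ℓ) = 1` (`localEulerFactor_quadraticTwist`,
  `localEulerFactor_quadraticTwist_four_mul_of_not_dvd`);
* at a place `v ∣ D` (including `v = 2`): the local factor of the twist is `1`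
  (`localEulerFactor_quadraticTwist_discr_eq_one_of_dvd`, from Artin formalism for `E_K / K`), and
  `χ_D` vanishes at the multiples of `ℓ`.

Everything is proved; no definitions and no named facts.

## References

* J. H. Silverman, *The Arithmetic of Elliptic Curves*, 2nd ed. 2009, X.2, X.5, Exercise 10.16.
* [Cox2013] D. A. Cox, *Primes of the form x² + ny²*, 2nd ed. (2013), §1.C Lemma 1.14.
* [IrelandRosen1990] K. Ireland, M. Rosen, *A Classical Introduction to Modern Number Theory*,
  2nd ed., Prop. 20.5.4(b).
-/

noncomputable section

open scoped Classical NumberTheorySymbols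

namespace WeierstrassCurve

open IsDedekindDomain IsDedekindDomain.HeightOneSpectrum NumberField Rat.HeightOneSpectrum IsLocalRing

variable (W : WeierstrassCurve ℚ) [W.IsElliptic]

/-- **The local factor of `E^{(4m)}` at an odd place `v ∤ 4m`** (prime `ℓ`): it is the rescaling by
`(m / ℓ)` of that of `E` — `4m` is an `ℓ`-adic unit, a square mod `ℓ` iff `(4m / ℓ) = (m / ℓ) = 1`
(`localEulerFactor_quadraticTwist`). [folklore] -/
theorem localEulerFactor_quadraticTwist_four_mul_of_not_dvd (m : ℤ) (v : HeightOneSpectrum (𝓞 ℚ))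
    (hvD : ¬ ((primesEquiv v : ℕ) : ℤ) ∣ 4 * m) :
    ((W.quadraticTwist ((4 * m : ℤ) : ℚ)).baseChange (v.adicCompletion ℚ)).localEulerFactor
        (v.adicCompletionIntegers ℚ) =
      ArithmeticFunction.ofPowerSeries (primesEquiv v : ℕ)
        (PowerSeries.rescale (J(m | (primesEquiv v : ℕ)))
          ((W.baseChange (v.adicCompletion ℚ)).localPowerSeries (v.adicCompletionIntegers ℚ))) := by
  haveI := Fact.mk (primesEquiv v).2
  haveI : NeZero (2 : v.adicCompletion ℚ) := ⟨by
    rw [← map_ofNat (algebraMap ℚ (v.adicCompletion ℚ)) 2]; exact (map_ne_zero _).mpr two_ne_zero⟩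
  haveI : (W.baseChange (v.adicCompletion ℚ)).IsElliptic := by
    change (W.map _).IsElliptic; infer_instance
  set ℓ : ℕ := (primesEquiv v : ℕ) with hℓ
  have hℓp : ℓ.Prime := (primesEquiv v).2
  have hℓ2 : ¬ (ℓ : ℤ) ∣ 2 := fun h ↦ hvD ((h.mul_right 2).trans ⟨m, by ring⟩)
  have hv2 : ℓ ≠ 2 := fun h ↦ hℓ2 (by rw [h, Nat.cast_ofNat])
  have hu := isUnit_adicCompletionIntegers_intCast v hvD
  have h2 : IsUnit (2 : v.adicCompletionIntegers ℚ) := by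
    have := isUnit_adicCompletionIntegers_intCast v hℓ2
    simpa using this
  -- the twist at `v`
  have htw : (W.quadraticTwist ((4 * m : ℤ) : ℚ)).baseChange (v.adicCompletion ℚ) =
      (W.baseChange (v.adicCompletion ℚ)).quadraticTwist
        (algebraMap (v.adicCompletionIntegers ℚ) (v.adicCompletion ℚ) hu.unit) := by
    rw [baseChange, map_quadraticTwist, IsUnit.unit_spec, algebraMap_adicCompletionIntegers_intCast]
    rfl
  rw [htw, localEulerFactor_quadraticTwist (v.adicCompletionIntegers ℚ) h2 _ hu.unit,
    natCard_residueField_adicCompletionIntegers v]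
  congr 2
  -- the sign: `4m` is a square in the residue field iff `(m / ℓ) = 1`
  obtain ⟨e, he⟩ := exists_residueField_ringEquiv_zmod v
  have hsq : IsSquare (residue _ ((hu.unit : (v.adicCompletionIntegers ℚ)ˣ) : v.adicCompletionIntegers ℚ)) ↔
      IsSquare (((4 * m : ℤ) : ZMod ℓ)) := by
    rw [IsUnit.unit_spec, ← isSquare_ringEquiv_iff e.toMulEquiv, RingEquiv.toMulEquiv_eq_coe,
      RingEquiv.coe_toMulEquiv, he]
  have hd0 : ((4 * m : ℤ) : ZMod ℓ) ≠ 0 := by rwa [Ne, ZMod.intCast_zmod_eq_zero_iff_dvd]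
  have h20 : ((2 : ℤ) : ZMod ℓ) ≠ 0 := by rwa [Ne, ZMod.intCast_zmod_eq_zero_iff_dvd]
  have h4m : legendreSym ℓ (4 * m) = legendreSym ℓ m := by
    rw [legendreSym.mul, show (4 : ℤ) = 2 ^ 2 by norm_num, legendreSym.sq_one' ℓ h20, one_mul]
  simp only [hsq]
  rw [← jacobiSym.legendreSym.to_jacobiSym, ← h4m]
  congr 1
  split_ifs with h
  · exact ((legendreSym.eq_one_iff ℓ hd0).mpr h).symm
  · exact ((legendreSym.eq_neg_one_iff ℓ).mpr h).symm

variable (K : Type) [Field K] [NumberField K]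

/-- **`aₙ(E^{(d_K)}) = χ_{d_K}(n) aₙ(E)` for all `n`, even discriminant**: for an elliptic curve
`E / ℚ` (any model `W`), a quadratic field `K` with `4 ∣ d_K = 4m`, and good reduction of `E` at
every prime dividing `d_K`, the Dirichlet coefficients of the twist by `d_K` are those of `E`
twisted by `n ↦ (m / n)` (`n` odd), `0` (`n` even) — the Kronecker character `(d_K / ·)` — including
at the primes dividing `d_K`, where both sides vanish (Silverman, *AEC* X.2, Exercise 10.16;
Gross–Zagier 1986, IV (0.1); Ireland–Rosen Prop. 20.5.4(b) for the ramified places).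
[cite: SilvermanAEC2009, X.2 and Exercise 10.16] -/
theorem LFunction_quadraticTwist_apply_of_four_dvd_discr (h2 : Module.finrank ℚ K = 2)
    (h4 : 4 ∣ NumberField.discr K)
    (hgood : ∀ v : HeightOneSpectrum (𝓞 ℚ), ((primesEquiv v : ℕ) : ℤ) ∣ NumberField.discr K →
      W.HasGoodReductionAt v) (n : ℕ) :
    (W.quadraticTwist (NumberField.discr K : ℚ)).LFunction n =
      (if Even n then 0 else J(NumberField.discr K / 4 | n)) * W.LFunction n := by
  set D := NumberField.discr K with hDdef
  set m : ℤ := D / 4 with hmdef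
  have hDm : D = 4 * m := by rw [hmdef]; exact (Int.mul_ediv_cancel' h4).symm
  have hD0 : D ≠ 0 := NumberField.discr_ne_zero K
  have hDq : (D : ℚ) ≠ 0 := by exact_mod_cast hD0
  haveI : (W.quadraticTwist (D : ℚ)).IsElliptic := W.isElliptic_quadraticTwist hDq
  -- the twisting function `ε(n) = χ_D(n)`
  set ε : ℕ → ℤ := fun n ↦ if Even n then 0 else J(m | n) with hε
  have hε1 : ε 1 = 1 := by simp [hε, jacobiSym.one_right]
  have hεmul : ∀ a b, ε (a * b) = ε a * ε b := by
    intro a b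
    by_cases ha : Even a
    · simp [hε, ha]
    · by_cases hb : Even b
      · simp [hε, hb]
      · have hab : ¬ Even (a * b) := by rw [Nat.even_mul, not_or]; exact ⟨ha, hb⟩
        simp only [hε, if_neg ha, if_neg hb, if_neg hab]
        exact jacobiSym.mul_right' m (Nat.not_even_iff_odd.mp ha).pos.ne'
          (Nat.not_even_iff_odd.mp hb).pos.ne'
  show (W.quadraticTwist (D : ℚ)).LFunction n = ε n * W.LFunction n
  rw [LFunction_eq_eulerProduct, LFunction_eq_eulerProduct]
  refine ArithmeticFunction.eulerProduct_apply_eq_mul_of_forall (P := fun _ ↦ True)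
    (fun _ _ _ ↦ ⟨trivial, trivial⟩) ε hε1 hεmul _ _ (fun v k _ ↦ ?_)
    (eventually_cofinite_localEulerFactor_apply _) (eventually_cofinite_localEulerFactor_apply _) trivial
  haveI := Fact.mk (primesEquiv v).2
  have hℓ1 : 1 < (primesEquiv v : ℕ) := (primesEquiv v).2.one_lt
  by_cases hvD : ((primesEquiv v : ℕ) : ℤ) ∣ D
  · -- ramified place: the factor of the twist is `1` and `ε` vanishes at the multiples of `ℓ`
    have hε0 : ε (primesEquiv v : ℕ) = 0 := by
      by_cases hv2 : (primesEquiv v : ℕ) = 2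
      · simp [hε, hv2]
      · have hodd : Odd (primesEquiv v : ℕ) := (primesEquiv v).2.odd_of_ne_two hv2
        simp only [hε, if_neg (Nat.not_even_iff_odd.mpr hodd)]
        haveI : NeZero (primesEquiv v : ℕ) := ⟨(primesEquiv v).2.ne_zero⟩
        rw [jacobiSym.eq_zero_iff_not_coprime, Int.gcd_comm, Int.gcd_eq_natAbs, Int.natAbs_natCast]
        intro hcop
        -- `ℓ ∣ m` as `ℓ ∣ 4m` and `ℓ` is odd
        have hℓm : (primesEquiv v : ℕ) ∣ m.natAbs := by
          have h := Int.natAbs_dvd_natAbs.mpr (hDm ▸ hvD)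
          rw [Int.natAbs_natCast, Int.natAbs_mul] at h
          refine Nat.Coprime.dvd_of_dvd_mul_left ?_ h
          simpa using Nat.Coprime.pow_right 2 (Nat.coprime_two_right.mpr hodd)
        exact (primesEquiv v).2.one_lt.ne' (Nat.Coprime.eq_one_of_dvd hcop hℓm)
    rw [W.localEulerFactor_quadraticTwist_discr_eq_one_of_dvd K h2 v hvD (hgood v hvD),
      ArithmeticFunction.one_apply]
    split_ifs with hk1
    · rw [hk1, localEulerFactor_apply_one, hε1, one_mul]
    · by_cases hpow : ∃ j, Nat.card (ResidueField (v.adicCompletionIntegers ℚ)) ^ j = k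
      · obtain ⟨j, rfl⟩ := hpow
        rw [natCard_residueField_adicCompletionIntegers] at hk1 ⊢
        have hj : j ≠ 0 := fun h ↦ hk1 (by rw [h, pow_zero])
        have hεpow : ∀ j : ℕ, ε ((primesEquiv v : ℕ) ^ j) = ε (primesEquiv v : ℕ) ^ j := by
          intro j
          induction j with
          | zero => rw [pow_zero, pow_zero, hε1]
          | succ j ih => rw [pow_succ, hεmul, ih, pow_succ]
        rw [hεpow, hε0, zero_pow hj, zero_mul]
      · rw [localEulerFactor_apply_eq_zero _ _ (by rwa [natCard_residueField_adicCompletionIntegers]) hpow,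
          mul_zero]
  · -- unramified place (`ℓ` odd, `ℓ ∤ 4m`)
    have hvD' : ¬ ((primesEquiv v : ℕ) : ℤ) ∣ 4 * m := hDm ▸ hvD
    have hodd : Odd (primesEquiv v : ℕ) := by
      refine (primesEquiv v).2.odd_of_ne_two fun h ↦ hvD' ?_
      rw [h]
      exact ⟨2 * m, by push_cast; ring⟩
    have hεℓ : ε (primesEquiv v : ℕ) = J(m | (primesEquiv v : ℕ)) := by
      simp only [hε, if_neg (Nat.not_even_iff_odd.mpr hodd)]
    have key : ((W.quadraticTwist (D : ℚ)).baseChange (v.adicCompletion ℚ)).localEulerFactor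
        (v.adicCompletionIntegers ℚ) =
        ArithmeticFunction.ofPowerSeries (primesEquiv v : ℕ)
          (PowerSeries.rescale (ε (primesEquiv v : ℕ))
            ((W.baseChange (v.adicCompletion ℚ)).localPowerSeries (v.adicCompletionIntegers ℚ))) := by
      rw [hεℓ, show (D : ℚ) = ((4 * m : ℤ) : ℚ) by rw [hDm]]
      exact W.localEulerFactor_quadraticTwist_four_mul_of_not_dvd m v hvD'
    rw [key, localEulerFactor, natCard_residueField_adicCompletionIntegers]
    exact ArithmeticFunction.ofPowerSeries_rescale_apply hℓ1 ε hε1 hεmul _ k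

end WeierstrassCurve

end
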